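import Summits.Langlands.Langlands.Theorems.IrregularClassicality.Negative.FiniteRangeCollapse

/-!
# `IrregularClassicality` (stmt-Langlands-13758) — Negative knowledge VII: both hypotheses of the
# PICKED line's Stub 1 `stub_placeOfMaximalIdeal` are load-bearing

From the standing disprover's `Cruxes/IrregularClassicality/Disproof.lean`, cdisprove cycle 4
(2026-08-16), §13.  Stub 1 of `Cruxes/IrregularClassicality/Lines/split-ramified-prime-sqrt6.lean`:
for every maximal `𝔐 ∋ 3` of `ℤ̄ = integralClosure ℤ ℂ` there is `ι : ℚ̄₃ ≃+* ℂ` (`ℚ̄₃ = PadicAlgCl 3`)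
ADAPTED to `𝔐`: `(∃ u ∉ 𝔐, u z ∈ (3^k)) → ‖ι⁻¹ z‖ ≤ 3^{-k}`.  The stub is TRUE (the drefute seat's
paper proof: conjugacy of the extensions of `|·|₃` to `ℚ̄` + Steinitz) and is a prover's to land;
here the disprover lands its TIGHTNESS, i.e. small models showing that any proof must use both
hypotheses on `𝔐`:

* `placeOfMaximalIdeal_false_without_three_mem`: a maximal `𝔐` above `2` (it exists and misses `3`,
  `exists_isMaximal_two_mem_three_not_mem`) has `u := 3 ∉ 𝔐` serving every `z`, so adaptedness
  would force `‖ι⁻¹ 1‖ = 1 ≤ 3⁻¹`;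
* `placeOfMaximalIdeal_false_without_isMaximal`: with maximality weakened to properness, `𝔐 = 3ℤ̄`
  and `z = u = √3` (`√3 ∉ 3ℤ̄` since `3` is not a unit of `ℤ̄`; `u z = 3 ∈ (3¹)`) would need
  `‖ι⁻¹ √3‖ ≤ 3⁻¹`, yet `‖ι⁻¹ √3‖² = ‖3‖ = 3⁻¹` for EVERY `ι` — maximality is what pins ONE
  `3`-adic place uniformly (Disproof item 15 / §10, now with a witness).

Mathlib (`PadicAlgCl`, `Padic.norm_p`) + the landed Negative file `FiniteRangeCollapse` (for the
maximal ideals of `ℤ̄` above `2` and `3`).  No statement here asserts a Theses decl. [folklore]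
-/

set_option linter.dupNamespace false

namespace Summit.Langlands.Langlands.Theorems.IrregularClassicality.Negative

open Polynomial

open scoped Classical

/-- `‖3‖ = 3⁻¹` in `ℚ̄₃ = PadicAlgCl 3` (the spectral norm extends the `3`-adic norm). [folklore] -/
theorem norm_three_padicAlgCl_three : ‖(3 : PadicAlgCl 3)‖ = (3 : ℝ)⁻¹ := by
  have h := PadicAlgCl.norm_extends 3 ((3 : ℕ) : ℚ_[3])
  rw [map_natCast, Padic.norm_p] at h
  exact_mod_cast h

/-- `3` is not a unit of `ℤ̄` (a maximal ideal lies above it). [folklore] -/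
theorem span_three_integralClosure_ne_top :
    Ideal.span {(3 : integralClosure ℤ ℂ)} ≠ ⊤ := by
  obtain ⟨𝔐, h𝔐, h3⟩ := exists_isMaximal_three_mem
  exact fun htop => h𝔐.ne_top (top_le_iff.1 (htop ▸ (Ideal.span_singleton_le_iff_mem _).2 h3))

/-- **Stub 1 is false without `3 ∈ 𝔐`.**  At a maximal `𝔐` of `ℤ̄` above `2` the element
`u := 3 ∉ 𝔐` serves every `z` and every depth, so an adapted `ι` would satisfy
`‖ι⁻¹ 1‖ = 1 ≤ 3⁻¹`. [folklore] -/
theorem placeOfMaximalIdeal_false_without_three_mem :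
    ¬ ∀ 𝔐 : Ideal (integralClosure ℤ ℂ), 𝔐.IsMaximal →
      ∃ ι : PadicAlgCl 3 ≃+* ℂ, ∀ (z : integralClosure ℤ ℂ) (k : ℕ),
        (∃ u : integralClosure ℤ ℂ, u ∉ 𝔐 ∧
          u * z ∈ Ideal.span {(3 : integralClosure ℤ ℂ) ^ k}) →
        ‖ι.symm (z : ℂ)‖ ≤ ((3 : ℝ)⁻¹) ^ k := by
  intro h
  obtain ⟨𝔐, h𝔐, -, h3⟩ := exists_isMaximal_two_mem_three_not_mem
  obtain ⟨ι, hι⟩ := h 𝔐 h𝔐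
  have h1 := hι 1 1 ⟨3, h3, by rw [mul_one, pow_one]; exact Ideal.mem_span_singleton_self _⟩
  simp only [OneMemClass.coe_one, map_one, norm_one, pow_one] at h1
  norm_num at h1

/-- **Stub 1 is false with `IsMaximal` weakened to "proper".**  For `𝔐 = 3ℤ̄ ∋ 3` (proper) take
`z = u = √3`: `u ∉ 3ℤ̄` (else `3 r² = 1` and `3` would be a unit), `u z = 3 ∈ (3¹)`, yet
`‖ι⁻¹ √3‖ · ‖ι⁻¹ √3‖ = ‖ι⁻¹ 3‖ = 3⁻¹` for every `ι`, contradicting `‖ι⁻¹ √3‖ ≤ 3⁻¹`.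
[folklore] -/
theorem placeOfMaximalIdeal_false_without_isMaximal :
    ¬ ∀ 𝔐 : Ideal (integralClosure ℤ ℂ), 𝔐 ≠ ⊤ → (3 : integralClosure ℤ ℂ) ∈ 𝔐 →
      ∃ ι : PadicAlgCl 3 ≃+* ℂ, ∀ (z : integralClosure ℤ ℂ) (k : ℕ),
        (∃ u : integralClosure ℤ ℂ, u ∉ 𝔐 ∧
          u * z ∈ Ideal.span {(3 : integralClosure ℤ ℂ) ^ k}) →
        ‖ι.symm (z : ℂ)‖ ≤ ((3 : ℝ)⁻¹) ^ k := by
  intro h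
  obtain ⟨ι, hι⟩ := h _ span_three_integralClosure_ne_top (Ideal.mem_span_singleton_self 3)
  -- a square root of 3 in ℂ, an algebraic integer
  obtain ⟨s, hs⟩ := IsAlgClosed.exists_pow_nat_eq (3 : ℂ) two_pos
  have hsint : IsIntegral ℤ s := by
    refine ⟨X ^ 2 - C 3, monic_X_pow_sub_C 3 two_ne_zero, ?_⟩
    simp [hs]
  let sZ : integralClosure ℤ ℂ := ⟨s, (mem_integralClosure_iff ℤ ℂ).2 hsint⟩
  have h3coe : ((3 : integralClosure ℤ ℂ) : ℂ) = 3 := map_ofNat (integralClosure ℤ ℂ).val 3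
  have hss : sZ * sZ = 3 := by
    apply Subtype.ext
    change s * s = ((3 : integralClosure ℤ ℂ) : ℂ)
    rw [h3coe, ← pow_two, hs]
  have hsn : sZ ∉ Ideal.span {(3 : integralClosure ℤ ℂ)} := by
    intro hmem
    obtain ⟨r, hr⟩ := Ideal.mem_span_singleton'.1 hmem
    apply span_three_integralClosure_ne_top
    rw [Ideal.eq_top_iff_one, Ideal.mem_span_singleton']
    have h9 : (3 : integralClosure ℤ ℂ) * (r * r * 3) = 3 * 1 := by
      linear_combination (3 * r + sZ) * hr + hss
    have h3ne : (3 : integralClosure ℤ ℂ) ≠ 0 := fun h0 => by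
      have := congrArg Subtype.val h0
      norm_num at this
    exact ⟨r * r, mul_left_cancel₀ h3ne h9⟩
  have hle := hι sZ 1 ⟨sZ, hsn, by rw [hss, pow_one]; exact Ideal.mem_span_singleton_self _⟩
  have hsq : ‖ι.symm (sZ : ℂ)‖ * ‖ι.symm (sZ : ℂ)‖ = (3 : ℝ)⁻¹ := by
    rw [← norm_mul, ← map_mul]
    have : (sZ : ℂ) * (sZ : ℂ) = 3 := by rw [← MulMemClass.coe_mul, hss]; exact h3coe
    rw [this, map_ofNat, norm_three_padicAlgCl_three]
  rw [pow_one] at hle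
  nlinarith [norm_nonneg (ι.symm (sZ : ℂ))]

end Summit.Langlands.Langlands.Theorems.IrregularClassicality.Negative
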